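import Summits.KontsevichZagierPeriods.KontsevichZagierPeriods.Theorems.HoffmanRelationInKZ.Negative.WindowInvariant

/-!
# Crux `HoffmanRelationInKZ` (stmt-KontsevichZagierPeriods-3930): the window invariant at the first live instance `s = (3)`

Landed copy of §3b (weight 4) of `Cruxes/HoffmanRelationInKZ/Disproof.lean` (crux disprover). On the box
`(1/2,3/5) × (1/5,1/4) × (3/20,1/5) × (1/20,1/10)` inside the 4-simplex the integrand gap
`ω₀ω₀ω₀ω₁ − ω₀ω₀ω₁ω₁ − ω₀ω₁ω₀ω₁` is positive (`integrand_gap_pos₄`), so window evaluation is positive on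
Hoffman's element at `s = (3)` and **additivity alone does not prove `ζ(4) = ζ(3,1) + ζ(2,2)`**
(`three_not_mem_addOnly`); with `CoefficientSum.lean` (`ε = −1`) a proof of the first live instance uses
an additivity move AND a change of variables or Newton–Leibniz move.
-/

noncomputable section

namespace Summit.KontsevichZagierPeriods.HoffmanRelationInKZ.Negative

open MeasureTheory Set
open Literature.NumberTheory.Transcendental
open Literature.NumberTheory.Transcendental.KZ
open Summit.KontsevichZagierPeriods.KontsevichZagierPeriods.Theses.FurushoPentagon

/-! ## The window invariant at `s = (3)` (weight 4) -/

section Window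


/-- The integrand of `ζ(4)`: `ω₀ω₀ω₀ω₁`. -/
theorem mzvIntegrand_four (t : Fin 4 → ℝ) :
    mzvIntegrand [4] t = (t 0)⁻¹ * (t 1)⁻¹ * (t 2)⁻¹ * (1 - t 3)⁻¹ := by
  change (∏ i : Fin 4, mzvForm ((MZV.binaryWord [4]).getD i false) (t i)) = _
  simp [Fin.prod_univ_four, mzvForm, MZV.binaryWord]

/-- The integrand of `ζ(3,1)`: `ω₀ω₀ω₁ω₁`. -/
theorem mzvIntegrand_three_one (t : Fin 4 → ℝ) :
    mzvIntegrand [3, 1] t = (t 0)⁻¹ * (t 1)⁻¹ * (1 - t 2)⁻¹ * (1 - t 3)⁻¹ := by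
  change (∏ i : Fin 4, mzvForm ((MZV.binaryWord [3, 1]).getD i false) (t i)) = _
  simp [Fin.prod_univ_four, mzvForm, MZV.binaryWord]

/-- The integrand of `ζ(2,2)`: `ω₀ω₁ω₀ω₁`. -/
theorem mzvIntegrand_two_two (t : Fin 4 → ℝ) :
    mzvIntegrand [2, 2] t = (t 0)⁻¹ * (1 - t 1)⁻¹ * (t 2)⁻¹ * (1 - t 3)⁻¹ := by
  change (∏ i : Fin 4, mzvForm ((MZV.binaryWord [2, 2]).getD i false) (t i)) = _
  simp [Fin.prod_univ_four, mzvForm, MZV.binaryWord]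

/-- Lower endpoints of the weight-4 box `(1/2,3/5) × (1/5,1/4) × (3/20,1/5) × (1/20,1/10)`. -/
def lo₄ : ℕ → ℝ := fun i => (([1/2, 1/5, 3/20, 1/20] : List ℚ).getD i 0 : ℚ)
/-- Upper endpoints of the weight-4 box. -/
def hi₄ : ℕ → ℝ := fun i => (([3/5, 1/4, 1/5, 1/10] : List ℚ).getD i 0 : ℚ)

/-- Coordinates of a point of the weight-4 box. [folklore] -/
theorem mem_window₄ {t : Fin 4 → ℝ} (ht : t ∈ window lo₄ hi₄ 4) :
    1/2 < t 0 ∧ t 0 < 3/5 ∧ 1/5 < t 1 ∧ t 1 < 1/4 ∧ 3/20 < t 2 ∧ t 2 < 1/5 ∧ 1/20 < t 3 ∧ t 3 < 1/10 := by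
  have h0 := ht 0; have h1 := ht 1; have h2 := ht 2; have h3 := ht 3
  simp only [lo₄, hi₄, mem_Ioo] at h0 h1 h2 h3
  norm_num at h0 h1 h2 h3
  exact ⟨h0.1, h0.2, h1.1, h1.2, h2.1, h2.2, h3.1, h3.2⟩

/-- The weight-4 box lies in the open ordered simplex. [folklore] -/
theorem window₄_subset : window lo₄ hi₄ 4 ⊆ openOrderedSimplex 4 := by
  intro t ht
  obtain ⟨h0, h0', h1, h1', h2, h2', h3, h3'⟩ := mem_window₄ ht
  refine ⟨fun i => ?_, fun i => ?_, fun i j hij => ?_⟩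
  · fin_cases i <;> simp <;> linarith
  · fin_cases i <;> simp <;> linarith
  · fin_cases i <;> fin_cases j <;> simp at hij ⊢ <;> linarith

/-- The weight-4 box is nonempty. [folklore] -/
theorem window₄_nonempty : (window lo₄ hi₄ 4).Nonempty := by
  refine ⟨![11/20, 9/40, 7/40, 3/40], fun i => ?_⟩
  fin_cases i <;> simp [lo₄, hi₄] <;> norm_num

/-- Pointwise positivity of `ω₀ω₀ω₀ω₁ − ω₀ω₀ω₁ω₁ − ω₀ω₁ω₀ω₁` on the weight-4 box: after the common factor
`1/(t₀(1 − t₃) t₁ t₂ (1 − t₁)(1 − t₂))` it is `1 − 2t₁ − 2t₂ + 3t₁t₂ > 1/10`. -/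
theorem integrand_gap_pos₄ {t : Fin 4 → ℝ} (ht : t ∈ window lo₄ hi₄ 4) :
    0 < mzvIntegrand [4] t - (mzvIntegrand [3, 1] t + mzvIntegrand [2, 2] t) := by
  obtain ⟨h0, h0', h1, h1', h2, h2', h3, h3'⟩ := mem_window₄ ht
  rw [mzvIntegrand_four, mzvIntegrand_three_one, mzvIntegrand_two_two]
  have n0 : t 0 ≠ 0 := by positivity
  have n1 : t 1 ≠ 0 := by positivity
  have n2 : t 2 ≠ 0 := by positivity
  have m1 : 1 - t 1 ≠ 0 := by linarith
  have m2 : 1 - t 2 ≠ 0 := by linarith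
  have m3 : 1 - t 3 ≠ 0 := by linarith
  have key : (t 0)⁻¹ * (t 1)⁻¹ * (t 2)⁻¹ * (1 - t 3)⁻¹ -
      ((t 0)⁻¹ * (t 1)⁻¹ * (1 - t 2)⁻¹ * (1 - t 3)⁻¹ + (t 0)⁻¹ * (1 - t 1)⁻¹ * (t 2)⁻¹ * (1 - t 3)⁻¹) =
      (1 - 2 * t 1 - 2 * t 2 + 3 * (t 1 * t 2)) / (t 0 * (1 - t 3) * t 1 * t 2 * (1 - t 1) * (1 - t 2)) := by
    field_simp
    ring
  rw [key]
  apply div_pos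
  · nlinarith [mul_pos (show (0:ℝ) < t 1 by linarith) (show (0:ℝ) < t 2 by linarith)]
  · have : 0 < t 1 * t 2 := mul_pos (by linarith) (by linarith)
    have : 0 < t 0 * (1 - t 3) := mul_pos (by linarith) (by linarith)
    have : 0 < (1 - t 1) * (1 - t 2) := mul_pos (by linarith) (by linarith)
    nlinarith [mul_pos (mul_pos ‹0 < t 0 * (1 - t 3)› ‹0 < t 1 * t 2›) ‹0 < (1 - t 1) * (1 - t 2)›]

/-- **The window separates `H(3)` from `0`.** -/
theorem windowEval_hoffmanElement_three_pos :
    0 < windowEval (window lo₄ hi₄) (hoffmanElement zetaRep [3]) := by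
  have h4 : MZV.IsAdmissible [4] := by decide
  have h31 : MZV.IsAdmissible [3, 1] := by decide
  have h22 : MZV.IsAdmissible [2, 2] := by decide
  rw [hoffmanElement_three, zetaRep_of_isAdmissible h4, zetaRep_of_isAdmissible h31,
    zetaRep_of_isAdmissible h22, map_sub, map_add, windowEval_of, windowEval_of, windowEval_of]
  change 0 < (∫ x in openOrderedSimplex 4 ∩ window lo₄ hi₄ 4, mzvIntegrand [4] x) -
    ((∫ x in openOrderedSimplex 4 ∩ window lo₄ hi₄ 4, mzvIntegrand [3, 1] x) +
      ∫ x in openOrderedSimplex 4 ∩ window lo₄ hi₄ 4, mzvIntegrand [2, 2] x)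
  rw [inter_eq_right.mpr window₄_subset]
  have i4 : IntegrableOn (fun x : Fin 4 → ℝ => mzvIntegrand [4] x) (window lo₄ hi₄ 4) :=
    (mzvIntegrand_integrableOn_holds [4] h4).mono_set window₄_subset
  have i31 : IntegrableOn (fun x : Fin 4 → ℝ => mzvIntegrand [3, 1] x) (window lo₄ hi₄ 4) :=
    (mzvIntegrand_integrableOn_holds [3, 1] h31).mono_set window₄_subset
  have i22 : IntegrableOn (fun x : Fin 4 → ℝ => mzvIntegrand [2, 2] x) (window lo₄ hi₄ 4) :=
    (mzvIntegrand_integrableOn_holds [2, 2] h22).mono_set window₄_subset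
  have i3122 : IntegrableOn (fun x : Fin 4 → ℝ => mzvIntegrand [3, 1] x + mzvIntegrand [2, 2] x)
      (window lo₄ hi₄ 4) := i31.add i22
  rw [← integral_add i31 i22, ← integral_sub i4 i3122]
  exact setIntegral_pos_of_pos_on (isOpen_window _ _ _) window₄_nonempty (fun t ht => integrand_gap_pos₄ ht)
    (i4.sub i3122)

/-- **Additivity alone does not prove `s = (3)`** (`ζ(4) = ζ(3,1) + ζ(2,2)`); with §3a (`ε = −1`):
any move-proof of the first live instance uses BOTH an additivity move and a change of variables or
Newton–Leibniz move. [folklore] -/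
theorem three_not_mem_addOnly : hoffmanElement zetaRep [3] ∉ addOnly := by
  intro h
  have h0 := addOnly_le_ker_windowEval (A := window lo₄ hi₄) (fun n => measurableSet_window _ _ n) h
  rw [AddMonoidHom.mem_ker] at h0
  exact (windowEval_hoffmanElement_three_pos).ne' h0

end Window


end Summit.KontsevichZagierPeriods.HoffmanRelationInKZ.Negative
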